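import Mathlib
import HarnessLib
import Summits.HubbardSuperconductivity.HubbardSuperconductivity.Theorems.KLProgrammeKLRegimeTwoVolumeFrameMismatchResum

/-!
# K3 legs at scale `n ≥ 1` (rows C1/C2 of stub (e), stmt-…-20437; VL (A3) scale-`n` step, stmt-…-20440): the covariance-response door AT THE READING STRING
# re-typed for the vertex `V_U + 𝒩_K` (counterterm kept as a vertex — the one-shot action's own vertex)

Cell gate-hubbard-kl, seat hubbard-kl-k3c4-p2 (g8).  p2 g10's door `covResp_norm_selfEnergy_sub_le` (…EngineCovarianceResponseAtPoint: Polchinski interpolation,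
Salmhofer's RGE read at the string `X_q = (ψ̂⁺_q, ψ̂⁻_q)`) is typed for the purely quartic `V_U`.  The frame-mismatch response of `…TwoVolumeFrameMismatchResum`
(p549694: `Σ[T(K₂)] − Σ[T(K₁)] = D(p_k⃗) + (Σ[𝒲′[Ψ̃]] − Σ[𝒲′[Ψ_{K₁}]])`, `𝒲′[s] := effAction (normalCovariance s) (V_U + 𝒩_{K₁})`) needs it for the vertex
`V_U + 𝒩_K`.  Everything the door uses of the vertex is: even, no constant part, invariant under every non-zero vertex-compatible charge scaling — all true for
`V_U + 𝒩_K` (§1, by …TwoPointAssemblyConservation's `map_scaling_hubbardInteraction` + `map_scaling_counterQuadratic`).  §2 is the door for `𝒲′[s]`, proofs =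
p2 g10's verbatim up to the vertex: selection rules (`covRespCT_kernel_two_eq_zero_of_charge_eq`, `…_pair_eq_zero_of_ne`), the tree term is a product
(`covRespCT_kernel_two_pairing_eq`), and **`covRespCT_norm_kernel_two_sub_le` / `covRespCT_norm_selfEnergy_sub_le`**:
`‖Σ[𝒲′[s₁]] − Σ[𝒲′[s₀]]‖(k,σ) ≤ 2|β|L²·(12·(Σ_p‖(s₁−s₀) p‖)·N + 2·‖(s₁−s₀)(k,σ)‖·S²)` under `Z_t ≠ 0`, four-leg kernels at the reading string `≤ N` and the two-leg
kernel `≤ S` along `C_t = C₀ + t(C₁ − C₀)`.  Composition with the shell-count entry sum of the defect: `…TwoVolumeFrameMismatchResponse`.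
Proofs only; no definitions; nothing about `N`, `S` is asserted; nothing asserts superconductivity.  References: Salmhofer 1998 §3.1 Prop. 1; FST 1996 §1.
-/

noncomputable section

namespace Summit.HubbardSuperconductivity.HubbardSuperconductivity.Theorems.TwoVolumeDefect

set_option linter.dupNamespace false -- summit = problem name (single-conjunct summit), D-0017

open Finset Complex Literature.MathematicalPhysics.QuantumLattice Literature.Probability.LatticeModels GrassmannAlgebra
open Summit.HubbardSuperconductivity.HubbardSuperconductivity.Theorems.KLRegimeSplit
open Summit.HubbardSuperconductivity.HubbardSuperconductivity.Theorems.KLProgrammeLegKernels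
open Summit.HubbardSuperconductivity.HubbardSuperconductivity.Theorems.EngineV8
open Summit.HubbardSuperconductivity.HubbardSuperconductivity.Theorems.TwoPointAssembly

variable {L M : ℕ} [NeZero L]

/-! ## §1 The vertex `V_U + 𝒩_K`: even, no constant part, invariant under vertex-compatible charge scalings -/

/-- `V_U + 𝒩_K ∈ evenOdd 0`. -/
theorem hubbardInteraction_add_counterQuadratic_mem_evenOdd_zero (β U : ℝ) (K : TrigPolyC4v) :
    hubbardInteraction L M β U + counterQuadratic L M β K ∈ evenOdd ℂ (ι := HubbardFieldIdx L M) 0 :=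
  mem_evenPart_iff.1 (hubbardInteraction_add_counterQuadratic_mem_evenPart β U K)

/-- `constPart (V_U + 𝒩_K) = 0`. -/
theorem constPart_hubbardInteraction_add_counterQuadratic (β U : ℝ) (K : TrigPolyC4v) :
    constPart ℂ (hubbardInteraction L M β U + counterQuadratic L M β K) = 0 := by
  rw [map_add, constPart_hubbardInteraction, constPart_counterQuadratic, add_zero]

/-- **`V_U + 𝒩_K` is invariant under every non-zero vertex-compatible charge scaling** (the counterterm vertex is diagonal: reciprocal weights cancel). -/
theorem map_scaling_hubbardInteraction_add_counterQuadratic (φ : FreqMomentum L M × Fin 2 → ℂ) (hφ : ∀ p, φ p ≠ 0)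
    (hV : ∀ k₁ k₂ k₃ k₄ : FreqMomentum L M,
      matsubaraInt M k₁.1 + matsubaraInt M k₃.1 = matsubaraInt M k₂.1 + matsubaraInt M k₄.1 ∧ k₁.2 + k₃.2 = k₂.2 + k₄.2 →
        φ (k₁, 0) * φ (k₃, 1) = φ (k₂, 0) * φ (k₄, 1))
    (β U : ℝ) (K : TrigPolyC4v) :
    ExteriorAlgebra.map (LinearMap.mulLeft ℂ (scalingWeight φ)) (hubbardInteraction L M β U + counterQuadratic L M β K) =
      hubbardInteraction L M β U + counterQuadratic L M β K := by
  rw [map_add, map_scaling_hubbardInteraction φ hφ hV, map_scaling_counterQuadratic φ hφ]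

/-! ## §2 The covariance-response door for `𝒲′[s] = effAction (normalCovariance s) (V_U + 𝒩_K)` -/

section Door

variable (β U : ℝ) (K : TrigPolyC4v)

/-- `𝒲′[s]` is invariant under every non-zero vertex-compatible charge scaling. -/
theorem covRespCT_map_scaling_effAction (φ : FreqMomentum L M × Fin 2 → ℂ) (hφ : ∀ p, φ p ≠ 0)
    (hV : ∀ k₁ k₂ k₃ k₄ : FreqMomentum L M,
      matsubaraInt M k₁.1 + matsubaraInt M k₃.1 = matsubaraInt M k₂.1 + matsubaraInt M k₄.1 ∧ k₁.2 + k₃.2 = k₂.2 + k₄.2 →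
        φ (k₁, 0) * φ (k₃, 1) = φ (k₂, 0) * φ (k₄, 1))
    (s : FreqMomentum L M × Fin 2 → ℂ) :
    ExteriorAlgebra.map (LinearMap.mulLeft ℂ (scalingWeight φ))
        (effAction ℂ (normalCovariance L M s) (hubbardInteraction L M β U + counterQuadratic L M β K)) =
      effAction ℂ (normalCovariance L M s) (hubbardInteraction L M β U + counterQuadratic L M β K) :=
  map_mulLeft_effAction_of_invariant ℂ (scalingWeightInv_mul φ hφ) (fun X Y => scalingWeight_normalCovariance_invariant φ hφ s X Y)
    (map_scaling_hubbardInteraction_add_counterQuadratic φ hφ hV β U K)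

/-- The selection rule under one compatible scaling. -/
theorem covRespCT_kernel_two_eq_zero_of_weight_ne (φ : FreqMomentum L M × Fin 2 → ℂ) (hφ : ∀ p, φ p ≠ 0)
    (hV : ∀ k₁ k₂ k₃ k₄ : FreqMomentum L M,
      matsubaraInt M k₁.1 + matsubaraInt M k₃.1 = matsubaraInt M k₂.1 + matsubaraInt M k₄.1 ∧ k₁.2 + k₃.2 = k₂.2 + k₄.2 →
        φ (k₁, 0) * φ (k₃, 1) = φ (k₂, 0) * φ (k₄, 1))
    (s : FreqMomentum L M × Fin 2 → ℂ) {X Y : HubbardFieldIdx L M} (hw : scalingWeight φ X * scalingWeight φ Y ≠ 1) :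
    kernel ℂ (effAction ℂ (normalCovariance L M s) (hubbardInteraction L M β U + counterQuadratic L M β K)) 2 ![X, Y] = 0 := by
  refine kernel_eq_zero_of_invariant ℂ (scalingWeight φ) (covRespCT_map_scaling_effAction β U K φ hφ hV s) ?_
  simpa [Fin.prod_univ_two] using hw

/-- **Charge conservation** for the two-leg kernel of `𝒲′[s]`. -/
theorem covRespCT_kernel_two_eq_zero_of_charge_eq (s : FreqMomentum L M × Fin 2 → ℂ) (p q : FreqMomentum L M × Fin 2) (c : Fin 2) :
    kernel ℂ (effAction ℂ (normalCovariance L M s) (hubbardInteraction L M β U + counterQuadratic L M β K)) 2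
      ![((p, c) : HubbardFieldIdx L M), (q, c)] = 0 := by
  refine covRespCT_kernel_two_eq_zero_of_weight_ne β U K (fun _ => (2 : ℂ)) (fun _ => two_ne_zero) (fun _ _ _ _ _ => rfl) s ?_
  fin_cases c <;> norm_num [scalingWeight]

/-- A vertex-compatible non-zero weight separating `p` from `q` kills both mixed-charge two-leg kernels of `𝒲′[s]` at `(p, q)`. -/
theorem covRespCT_kernel_two_pair_eq_zero_of_separating (φ : FreqMomentum L M × Fin 2 → ℂ) (hφ : ∀ p, φ p ≠ 0)
    (hV : ∀ k₁ k₂ k₃ k₄ : FreqMomentum L M,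
      matsubaraInt M k₁.1 + matsubaraInt M k₃.1 = matsubaraInt M k₂.1 + matsubaraInt M k₄.1 ∧ k₁.2 + k₃.2 = k₂.2 + k₄.2 →
        φ (k₁, 0) * φ (k₃, 1) = φ (k₂, 0) * φ (k₄, 1))
    (s : FreqMomentum L M × Fin 2 → ℂ) {p q : FreqMomentum L M × Fin 2} (h : φ p ≠ φ q) :
    kernel ℂ (effAction ℂ (normalCovariance L M s) (hubbardInteraction L M β U + counterQuadratic L M β K)) 2
        ![((p, 1) : HubbardFieldIdx L M), (q, 0)] = 0 ∧
      kernel ℂ (effAction ℂ (normalCovariance L M s) (hubbardInteraction L M β U + counterQuadratic L M β K)) 2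
        ![((p, 0) : HubbardFieldIdx L M), (q, 1)] = 0 :=
  ⟨covRespCT_kernel_two_eq_zero_of_weight_ne β U K φ hφ hV s (scalingWeight_pair_ne_one hφ h),
    covRespCT_kernel_two_eq_zero_of_weight_ne β U K φ hφ hV s (scalingWeight_pair_ne_one' hφ h)⟩

/-- **Conservation of frequency, momentum and spin** for the mixed-charge two-leg kernels of `𝒲′[s]`. -/
theorem covRespCT_kernel_two_pair_eq_zero_of_ne (s : FreqMomentum L M × Fin 2 → ℂ) {p q : FreqMomentum L M × Fin 2} (hpq : p ≠ q) :
    kernel ℂ (effAction ℂ (normalCovariance L M s) (hubbardInteraction L M β U + counterQuadratic L M β K)) 2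
        ![((p, 1) : HubbardFieldIdx L M), (q, 0)] = 0 ∧
      kernel ℂ (effAction ℂ (normalCovariance L M s) (hubbardInteraction L M β U + counterQuadratic L M β K)) 2
        ![((p, 0) : HubbardFieldIdx L M), (q, 1)] = 0 := by
  obtain ⟨⟨ω, k⟩, σ⟩ := p
  obtain ⟨⟨ω', k'⟩, σ'⟩ := q
  by_cases hω : ω = ω'
  · subst hω
    by_cases hk : k = k'
    · subst hk
      have hσ : σ ≠ σ' := fun h => hpq (by rw [h])
      refine covRespCT_kernel_two_pair_eq_zero_of_separating β U K (fun p => if p.2 = 0 then 2 else 1)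
        (fun p => by split_ifs <;> norm_num) (fun k₁ k₂ k₃ k₄ _ => by simp) s ?_
      fin_cases σ <;> fin_cases σ' <;> first | exact absurd rfl hσ | norm_num
    · obtain ⟨i, hi⟩ : ∃ i, k i ≠ k' i := Function.ne_iff.mp hk
      refine covRespCT_kernel_two_pair_eq_zero_of_separating β U K (fun p => (ZMod.stdAddChar (p.1.2 i) : ℂ))
        (fun p => stdAddChar_ne_zero _) (fun k₁ k₂ k₃ k₄ h => ?_) s ?_
      · rw [← AddChar.map_add_eq_mul, ← AddChar.map_add_eq_mul, ← Pi.add_apply k₁.2, ← Pi.add_apply k₂.2, h.2]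
      · exact fun h => hi (ZMod.injective_stdAddChar h)
  · refine covRespCT_kernel_two_pair_eq_zero_of_separating β U K (fun p => (2 : ℂ) ^ (matsubaraInt M p.1.1))
      (fun p => zpow_ne_zero _ two_ne_zero) (fun k₁ k₂ k₃ k₄ h => ?_) s ?_
    · rw [← zpow_add₀ two_ne_zero, ← zpow_add₀ two_ne_zero, h.1]
    · intro h
      dsimp only at h
      apply hω
      have h2 := two_zpow_injective h
      unfold matsubaraInt at h2
      exact Fin.ext (by omega)

/-- **The tree (pairing) term of the response at `X_q = (ψ̂⁺_q, ψ̂⁻_q)` is a PRODUCT** for `𝒲′[s]`: `kernel (δ𝒲′/δψ, Ċ δ𝒲′/δψ) 2 X_q = 4·ṡ(q)·𝒲′₂(X_q)²`. -/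
theorem covRespCT_kernel_two_pairing_eq (sdot s : FreqMomentum L M × Fin 2 → ℂ) (q : FreqMomentum L M × Fin 2) :
    kernel ℂ (grassmannDerivPairing ℂ (normalCovariance L M sdot)
        (effAction ℂ (normalCovariance L M s) (hubbardInteraction L M β U + counterQuadratic L M β K))
        (effAction ℂ (normalCovariance L M s) (hubbardInteraction L M β U + counterQuadratic L M β K))) 2
        ![((q, 0) : HubbardFieldIdx L M), (q, 1)] =
      4 * sdot q * (kernel ℂ (effAction ℂ (normalCovariance L M s) (hubbardInteraction L M β U + counterQuadratic L M β K)) 2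
        ![((q, 0) : HubbardFieldIdx L M), (q, 1)]) ^ 2 := by
  classical
  set W := effAction ℂ (normalCovariance L M s) (hubbardInteraction L M β U + counterQuadratic L M β K) with hW
  have hWe : W ∈ evenOdd ℂ (ι := HubbardFieldIdx L M) 0 :=
    mem_evenPart_iff.1 (effAction_mem_evenPart _ (hubbardInteraction_add_counterQuadratic_mem_evenPart β U K)
      (constPart_hubbardInteraction_add_counterQuadratic β U K))
  have hcc : ∀ (p : FreqMomentum L M × Fin 2) (c : Fin 2), kernel ℂ W 2 ![((p, c) : HubbardFieldIdx L M), (q, c)] = 0 :=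
    fun p c => by rw [hW]; exact covRespCT_kernel_two_eq_zero_of_charge_eq β U K s p q c
  have hne : ∀ p : FreqMomentum L M × Fin 2, p ≠ q → kernel ℂ W 2 ![((p, 0) : HubbardFieldIdx L M), (q, 1)] = 0 :=
    fun p hp => by rw [hW]; exact (covRespCT_kernel_two_pair_eq_zero_of_ne β U K s hp).2
  rw [kernel_two_grassmannDerivPairing ℂ _ hWe hWe]
  simp only [Matrix.cons_val_zero, Matrix.cons_val_one]
  have hinner : ∀ A : HubbardFieldIdx L M, ∑ B, normalCovariance L M sdot A B *
      (kernel ℂ W 2 ![A, ((q, 0) : HubbardFieldIdx L M)] * kernel ℂ W 2 ![B, ((q, 1) : HubbardFieldIdx L M)] -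
        kernel ℂ W 2 ![A, ((q, 1) : HubbardFieldIdx L M)] * kernel ℂ W 2 ![B, ((q, 0) : HubbardFieldIdx L M)]) =
      normalCovariance L M sdot A (A.1, 1 - A.2) *
        (kernel ℂ W 2 ![A, ((q, 0) : HubbardFieldIdx L M)] * kernel ℂ W 2 ![(A.1, 1 - A.2), ((q, 1) : HubbardFieldIdx L M)] -
          kernel ℂ W 2 ![A, ((q, 1) : HubbardFieldIdx L M)] * kernel ℂ W 2 ![(A.1, 1 - A.2), ((q, 0) : HubbardFieldIdx L M)]) :=
    fun A => Finset.sum_eq_single (A.1, 1 - A.2) (fun B _ hB => by rw [normalCovariance_eq_zero_of_ne_bar sdot A B hB, zero_mul])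
      (fun h => absurd (mem_univ _) h)
  simp_rw [hinner]
  rw [Fintype.sum_prod_type]
  have hterm : ∀ p : FreqMomentum L M × Fin 2, ∑ c : Fin 2, normalCovariance L M sdot (p, c) (p, 1 - c) *
      (kernel ℂ W 2 ![((p, c) : HubbardFieldIdx L M), (q, 0)] * kernel ℂ W 2 ![((p, 1 - c) : HubbardFieldIdx L M), (q, 1)] -
        kernel ℂ W 2 ![((p, c) : HubbardFieldIdx L M), (q, 1)] * kernel ℂ W 2 ![((p, 1 - c) : HubbardFieldIdx L M), (q, 0)]) =
      -2 * sdot p * (kernel ℂ W 2 ![((p, 0) : HubbardFieldIdx L M), (q, 1)] * kernel ℂ W 2 ![((p, 1) : HubbardFieldIdx L M), (q, 0)]) := by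
    intro p
    rw [Fin.sum_univ_two]
    simp only [Fin.isValue, sub_zero, sub_self, (normalCovariance_bar sdot p).1, (normalCovariance_bar sdot p).2, hcc p 0, hcc p 1]
    ring
  simp_rw [hterm]
  rw [Finset.sum_eq_single q (fun p _ hp => by rw [hne p hp, zero_mul, mul_zero]) (fun h => absurd (mem_univ _) h),
    KLRegimeWick.kernel_two_swap01 W ((q, 0) : HubbardFieldIdx L M) ((q, 1) : HubbardFieldIdx L M)]
  ring

/-- **THE COVARIANCE RESPONSE OF THE TWO-LEG KERNEL OF `𝒲′` AT THE READING STRING** (Polchinski interpolation, mean-value form; p2 g10's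
`covResp_norm_kernel_two_sub_le` for the vertex `V_U + 𝒩_K`): `‖𝒲′[s₁]₂(X_q) − 𝒲′[s₀]₂(X_q)‖ ≤ 12·(Σ_p ‖(s₁−s₀) p‖)·N + 2·‖(s₁−s₀) q‖·S²`.
[cite: Salmhofer1998, §3.1 Prop. 1] -/
theorem covRespCT_norm_kernel_two_sub_le (s₀ s₁ : FreqMomentum L M × Fin 2 → ℂ) (q : FreqMomentum L M × Fin 2)
    (hZ : ∀ t ∈ Set.Icc (0 : ℝ) 1, effPartitionFn ℂ (normalCovariance L M s₀ + ((t : ℂ)) • (normalCovariance L M s₁ - normalCovariance L M s₀))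
      (hubbardInteraction L M β U + counterQuadratic L M β K) ≠ 0)
    {N S : ℝ}
    (hN : ∀ t ∈ Set.Icc (0 : ℝ) 1, ∀ A : HubbardFieldIdx L M,
      ‖kernel ℂ (effAction ℂ (normalCovariance L M s₀ + ((t : ℂ)) • (normalCovariance L M s₁ - normalCovariance L M s₀))
        (hubbardInteraction L M β U + counterQuadratic L M β K)) 4
        (Fin.snoc (Fin.snoc ![((q, 0) : HubbardFieldIdx L M), (q, 1)] (A.1, 1 - A.2) : Fin 3 → HubbardFieldIdx L M) A)‖ ≤ N)
    (hS : ∀ t ∈ Set.Icc (0 : ℝ) 1,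
      ‖kernel ℂ (effAction ℂ (normalCovariance L M s₀ + ((t : ℂ)) • (normalCovariance L M s₁ - normalCovariance L M s₀))
        (hubbardInteraction L M β U + counterQuadratic L M β K)) 2 ![((q, 0) : HubbardFieldIdx L M), (q, 1)]‖ ≤ S) :
    ‖kernel ℂ (effAction ℂ (normalCovariance L M s₁) (hubbardInteraction L M β U + counterQuadratic L M β K)) 2
          ![((q, 0) : HubbardFieldIdx L M), (q, 1)] -
        kernel ℂ (effAction ℂ (normalCovariance L M s₀) (hubbardInteraction L M β U + counterQuadratic L M β K)) 2
          ![((q, 0) : HubbardFieldIdx L M), (q, 1)]‖ ≤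
      12 * (∑ p, ‖s₁ p - s₀ p‖) * N + 2 * ‖s₁ q - s₀ q‖ * S ^ 2 := by
  classical
  letI : LinearOrder (HubbardFieldIdx L M) := LinearOrder.lift' (Fintype.equivFin _) (Fintype.equivFin _).injective
  set X : Fin 2 → HubbardFieldIdx L M := ![((q, 0) : HubbardFieldIdx L M), (q, 1)] with hX
  let Φ : HubbardGrassmann L M →ₗ[ℂ] ℂ :=
    { toFun := fun F => kernel ℂ F 2 X
      map_add' := fun F G => kernel_add ℂ F G 2 X
      map_smul' := fun c F => by rw [kernel_smul, RingHom.id_apply, smul_eq_mul] }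
  have hΦ1 : Φ 1 = 0 := by
    show kernel ℂ (1 : HubbardGrassmann L M) 2 X = 0
    rw [kernel_def, iterDeriv_succ_apply, grassmannDeriv_one, map_zero, map_zero, mul_zero]
  have hV0 := constPart_hubbardInteraction_add_counterQuadratic (L := L) (M := M) β U K
  have hVe := hubbardInteraction_add_counterQuadratic_mem_evenOdd_zero (L := L) (M := M) β U K
  refine norm_apply_effAction_sub_le_of_linePath (normalCovariance L M s₀) (normalCovariance L M s₁) hV0 hVe hZ Φ hΦ1 ?_
  intro t ht
  have hNt := hN t ht
  have hSt0 := hS t ht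
  rw [normalCovariance_linePath, normalCovariance_sub]
  rw [normalCovariance_linePath] at hNt hSt0
  set st : FreqMomentum L M × Fin 2 → ℂ := fun p => s₀ p + (t : ℂ) * (s₁ p - s₀ p) with hst
  set W := effAction ℂ (normalCovariance L M st) (hubbardInteraction L M β U + counterQuadratic L M β K) with hW
  have hloop : ‖Φ (grassmannLaplacian ℂ (normalCovariance L M fun p => s₁ p - s₀ p) W)‖ ≤ 12 * (∑ p, ‖s₁ p - s₀ p‖) * N :=
    covResp_norm_kernel_two_laplacian_le (fun p => s₁ p - s₀ p) W X hNt
  have htree : Φ (grassmannDerivPairing ℂ (normalCovariance L M fun p => s₁ p - s₀ p) W W) =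
      4 * (s₁ q - s₀ q) * (kernel ℂ W 2 X) ^ 2 :=
    covRespCT_kernel_two_pairing_eq β U K (fun p => s₁ p - s₀ p) st q
  have hSt : ‖kernel ℂ W 2 X‖ ≤ S := hSt0
  have hS0 : 0 ≤ S := (norm_nonneg _).trans hSt
  calc ‖Φ (grassmannLaplacian ℂ (normalCovariance L M fun p => s₁ p - s₀ p) W) -
        (2 : ℂ)⁻¹ * Φ (grassmannDerivPairing ℂ (normalCovariance L M fun p => s₁ p - s₀ p) W W)‖
      ≤ ‖Φ (grassmannLaplacian ℂ (normalCovariance L M fun p => s₁ p - s₀ p) W)‖ +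
          ‖(2 : ℂ)⁻¹ * Φ (grassmannDerivPairing ℂ (normalCovariance L M fun p => s₁ p - s₀ p) W W)‖ := norm_sub_le _ _
    _ ≤ 12 * (∑ p, ‖s₁ p - s₀ p‖) * N + 2 * ‖s₁ q - s₀ q‖ * S ^ 2 := by
      refine add_le_add hloop ?_
      rw [htree, norm_mul, norm_mul, norm_mul, norm_pow, norm_inv, RCLike.norm_ofNat, RCLike.norm_ofNat]
      have : ‖kernel ℂ W 2 X‖ ^ 2 ≤ S ^ 2 := pow_le_pow_left₀ (norm_nonneg _) hSt 2
      nlinarith [norm_nonneg (s₁ q - s₀ q)]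

/-- **The same in the `selfEnergy` normalisation**: `‖Σ[𝒲′[s₁]](k,σ) − Σ[𝒲′[s₀]](k,σ)‖ ≤ 2|β|L²·(12·(Σ_p ‖(s₁−s₀) p‖)·N + 2·‖(s₁−s₀)(k,σ)‖·S²)`.
[cite: Salmhofer1998, §3.1 Prop. 1] -/
theorem covRespCT_norm_selfEnergy_sub_le (s₀ s₁ : FreqMomentum L M × Fin 2 → ℂ) (k : FreqMomentum L M) (σ : Fin 2)
    (hZ : ∀ t ∈ Set.Icc (0 : ℝ) 1, effPartitionFn ℂ (normalCovariance L M s₀ + ((t : ℂ)) • (normalCovariance L M s₁ - normalCovariance L M s₀))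
      (hubbardInteraction L M β U + counterQuadratic L M β K) ≠ 0)
    {N S : ℝ}
    (hN : ∀ t ∈ Set.Icc (0 : ℝ) 1, ∀ A : HubbardFieldIdx L M,
      ‖kernel ℂ (effAction ℂ (normalCovariance L M s₀ + ((t : ℂ)) • (normalCovariance L M s₁ - normalCovariance L M s₀))
        (hubbardInteraction L M β U + counterQuadratic L M β K)) 4
        (Fin.snoc (Fin.snoc ![(((k, σ), 0) : HubbardFieldIdx L M), ((k, σ), 1)] ((A.1, 1 - A.2)) : Fin 3 → HubbardFieldIdx L M) A)‖ ≤ N)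
    (hS : ∀ t ∈ Set.Icc (0 : ℝ) 1,
      ‖kernel ℂ (effAction ℂ (normalCovariance L M s₀ + ((t : ℂ)) • (normalCovariance L M s₁ - normalCovariance L M s₀))
        (hubbardInteraction L M β U + counterQuadratic L M β K)) 2 ![(((k, σ), 0) : HubbardFieldIdx L M), ((k, σ), 1)]‖ ≤ S) :
    ‖selfEnergy L M β (effAction ℂ (normalCovariance L M s₁) (hubbardInteraction L M β U + counterQuadratic L M β K)) k σ -
        selfEnergy L M β (effAction ℂ (normalCovariance L M s₀) (hubbardInteraction L M β U + counterQuadratic L M β K)) k σ‖ ≤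
      2 * (|β| * (L : ℝ) ^ 2) * (12 * (∑ p, ‖s₁ p - s₀ p‖) * N + 2 * ‖s₁ (k, σ) - s₀ (k, σ)‖ * S ^ 2) := by
  have h := covRespCT_norm_kernel_two_sub_le β U K s₀ s₁ (k, σ) hZ hN hS
  rw [selfEnergy, selfEnergy, vertexFn_def, vertexFn_def, ← mul_sub, norm_mul]
  have hc : ‖((((2 : ℕ).factorial : ℝ) * (β * (L : ℝ) ^ 2) ^ (2 - 1) : ℝ) : ℂ)‖ = 2 * (|β| * (L : ℝ) ^ 2) := by
    rw [Complex.norm_real, Real.norm_eq_abs, Nat.factorial_two]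
    simp [abs_mul, abs_pow]
  rw [hc]
  exact mul_le_mul_of_nonneg_left h (by positivity)

end Door

end Summit.HubbardSuperconductivity.HubbardSuperconductivity.Theorems.TwoVolumeDefect

end
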